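import Mathlib
import Literature.Analysis.FluidPDE.SelfSimilarEulerProfile
import Literature.Analysis.FluidPDE.SelfSimilarEulerOutgoingExclusionTools
import Summits.NavierStokesRegularity.NavierStokesRegularity.Theorems.EulerZoomLiouvillePowerGaugeEulerLiouvilleOutflowDiveExit
import Summits.NavierStokesRegularity.NavierStokesRegularity.Theorems.EulerZoomLiouvillePowerGaugeEulerLiouvilleOutflowDiveHeadGain
import Summits.NavierStokesRegularity.NavierStokesRegularity.Theorems.EulerZoomLiouvillePowerGaugeEulerLiouvilleOutflowDiveVorticityTransport
import HarnessLib

/-!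
# «NO LONG OUTFLOW DIVES» — the dive lemma of line `outflow_dive` assembled from D1–D3
# (crux `EulerZoomLiouville.PowerGaugeEulerLiouville` = stmt-NavierStokesRegularity-19832; line `outflow_dive` of ns-idea-11 g7)

Route `EulerZoomLiouville` (NavierStokesRegularity), crux E, LEAD seat ns-typeII-p2 g13.  Let `(V, P′)` be a classical self-similar
Euler profile about `0` at the class rate `γ = 1/(2+ρ)`, `ρ ∈ (0, ½]` (CIV (3.3)), `W y = γy + V y`, `ℋ = ½‖W‖² + P′ + ½γ(γ−1)‖y‖²`.

* `OutflowDive.outflowDive` — **VERBATIM the Prop `OutflowDive.Sig.stub_outflowDive` of `Cruxes/PowerGaugeEulerLiouville/Lines/outflow_dive.lean`**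
  («NO LONG OUTFLOW DIVES», CLASS-FREE): for `c₁ > 0`, a level `h` and a radius `R₁` there is `R₂` such that every point `y` with
  `‖y‖ ≥ R₂`, `ℋ y > h`, `curl V y ≠ 0` and `c₁‖y‖² ≤ ⟪y, W y⟫` (fast OUTFLOW) admits a point `y′` with `R₁ ≤ ‖y′‖ ≤ ‖y‖`, `ℋ y′ > h`,
  `curl V y′ ≠ 0` and `−c₁‖y′‖² < ⟪y′, W y′⟫ ≤ c₁‖y′‖²` (SWIRL RANGE).  Proof = the line's kernel-checked composition `outflowDive_of`
  run over the three tree theorems: D1 `OutflowDive.exists_outflowExit` (this seat, `…OutflowDiveExit`: the backward orbit up to its first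
  exit from the outflow mode), D2 `OutflowDive.headGain` (ns-ezl-w1 g5, `…OutflowDiveHeadGain`: head gain `½(1−2γ)c₁(‖y‖² − ‖Y‖²)`),
  D3 `OutflowDive.vorticityTransport` (ns-ezl-w1 g5, `…OutflowDiveVorticityTransport`: vorticity is transported along the arc); with
  `R₂ := max R₁ 1 + 1 + (|C − h| + 1)/κ`, `κ = ½(1−2γ)c₁`, `C = max_{‖z‖ ≤ max R₁ 1} |ℋ|`: the floor alternative of D1 would put the head
  above `C` — absurd — so the exit alternative holds and `y′ := Y σ₁` has all six properties.
* `OutflowDive.continuous_selfSimilarBernoulli` — `ℋ` is continuous (from `IsSelfSimilarEulerProfile.contDiff_selfSimilarBernoulli`).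

Reading for THE ONE STATEMENT (`Birth.Sig.stub_selfSimilarC2Needle`): OUTFLOW IS NOT A FACE — with this theorem the line's
`swirlFace_of_dive` reduces FACE A of `needle_faces` to T1 proper (`stub_swirlRangeFace`) and T2 (`stub_pressureFace`).

WHAT THIS IS NOT: not NS, not E — a class-free portrait lemma about `C²` profiles (no budgets, no needle data), `--supports` stmt-19832;
DENT 0 on the registered stubs; the crux is OPEN; NS regularity is NOT proved. [folklore; cf. ConstantinIgnatovaVicol2026Putative §3.4]
-/

noncomputable section

-- flat `Theorems/<Route><Decl>…` files of one crux share the namespace of the crux (tree convention: `Summit.<S>.<S>.…`)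
set_option linter.dupNamespace false

open Set Filter Topology Metric
open scoped RealInnerProductSpace

namespace Summit.NavierStokesRegularity.NavierStokesRegularity.Theorems.PowerGaugeEulerLiouville

open Literature.Analysis Literature.Analysis.FluidPDE

namespace OutflowDive

/-- The Bernoulli function of a classical profile is continuous. [cite: ConstantinIgnatovaVicol2026Putative, §3.4.3 eq. (3.30)] -/
theorem continuous_selfSimilarBernoulli {γ : ℝ} {V : EuclideanSpace ℝ (Fin 3) → EuclideanSpace ℝ (Fin 3)}
    {P' : EuclideanSpace ℝ (Fin 3) → ℝ} (hprof : IsSelfSimilarEulerProfile γ 0 V P') :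
    Continuous (selfSimilarBernoulli γ 0 V P') :=
  hprof.contDiff_selfSimilarBernoulli.continuous

/-- **«NO LONG OUTFLOW DIVES»** (VERBATIM `OutflowDive.Sig.stub_outflowDive` of `Lines/outflow_dive.lean`, CLASS-FREE): for `ρ ∈ (0, ½]`
(`γ = 1/(2+ρ) < ½`), a classical self-similar Euler profile `(V, P′)` about `0`, a rate `c₁ > 0`, a level `h` and a radius `R₁`, there is
`R₂` such that every point `y` with `‖y‖ ≥ R₂`, `ℋ y > h`, `curl V y ≠ 0` and `⟪y, W y⟫ ≥ c₁‖y‖²` (fast OUTFLOW) admits a point `y′` with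
`R₁ ≤ ‖y′‖ ≤ ‖y‖`, `ℋ y′ > h`, `curl V y′ ≠ 0` and `−c₁‖y′‖² < ⟪y′, W y′⟫ ≤ c₁‖y′‖²` (swirl range).  Composition of D1 (`exists_outflowExit`),
D2 (`headGain`, ns-ezl-w1 g5) and D3 (`vorticityTransport`, ns-ezl-w1 g5) exactly as in the line's `outflowDive_of`.
[folklore; cf. ConstantinIgnatovaVicol2026Putative §3.4 (3.19)–(3.20), §3.4.3 (3.31)] -/
theorem outflowDive : ∀ ρ : ℝ, 0 < ρ → ρ ≤ 1 / 2 →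
    ∀ (V : EuclideanSpace ℝ (Fin 3) → EuclideanSpace ℝ (Fin 3)) (P' : EuclideanSpace ℝ (Fin 3) → ℝ),
      IsSelfSimilarEulerProfile (1 / (2 + ρ)) 0 V P' →
      ∀ c₁ : ℝ, 0 < c₁ → ∀ h R₁ : ℝ, ∃ R₂ : ℝ, ∀ y : EuclideanSpace ℝ (Fin 3), R₂ ≤ ‖y‖ →
        h < selfSimilarBernoulli (1 / (2 + ρ)) 0 V P' y →
          curl V y ≠ 0 →
            c₁ * ‖y‖ ^ 2 ≤ inner ℝ y (selfSimilarTransport (1 / (2 + ρ)) 0 V y) →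
              ∃ y' : EuclideanSpace ℝ (Fin 3), R₁ ≤ ‖y'‖ ∧ ‖y'‖ ≤ ‖y‖ ∧
                h < selfSimilarBernoulli (1 / (2 + ρ)) 0 V P' y' ∧
                  curl V y' ≠ 0 ∧
                    -(c₁ * ‖y'‖ ^ 2) < inner ℝ y' (selfSimilarTransport (1 / (2 + ρ)) 0 V y') ∧
                      inner ℝ y' (selfSimilarTransport (1 / (2 + ρ)) 0 V y') ≤ c₁ * ‖y'‖ ^ 2 := by
  intro ρ hρ hρ' V P' hprof c₁ hc₁ h R₁
  -- friction constant κ = ½(1−2γ)c₁ > 0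
  have hγlt : 1 / (2 + ρ) < 1 / 2 :=
    one_div_lt_one_div_of_lt (by norm_num : (0 : ℝ) < 2) (by linarith : (2 : ℝ) < 2 + ρ)
  set κ : ℝ := 1 / 2 * (1 - 2 * (1 / (2 + ρ))) * c₁ with hκ_def
  have hκ : 0 < κ := by
    have : 0 < 1 - 2 * (1 / (2 + ρ)) := by linarith
    positivity
  -- floor radius R₁' ≥ 1 and a bound C for ℋ on the closed ball of radius R₁'
  set R₁' : ℝ := max R₁ 1 with hR₁'_def
  have hR₁'pos : 0 < R₁' := lt_of_lt_of_le one_pos (le_max_right _ _)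
  have hcont := continuous_selfSimilarBernoulli hprof
  obtain ⟨C, hC⟩ := (isCompact_closedBall (0 : EuclideanSpace ℝ (Fin 3)) R₁').exists_bound_of_continuousOn hcont.continuousOn
  -- threshold radius
  refine ⟨R₁' + 1 + (|C - h| + 1) / κ, fun y hy hh hcurl hout => ?_⟩
  have hdiv_nonneg : 0 ≤ (|C - h| + 1) / κ := by positivity
  have hyR : R₁' < ‖y‖ := by linarith
  obtain ⟨σ₁, hσ₁, Y, hY0, hYder, hYin, hexit⟩ := exists_outflowExit ρ hρ hρ' V P' hprof c₁ hc₁ R₁' hR₁'pos y hyR hout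
  have hgain := headGain ρ hρ hρ' V P' hprof c₁ hc₁ σ₁ hσ₁ Y hYder (fun σ hσ => (hYin σ hσ).2.2)
  rw [hY0] at hgain
  have hmem : σ₁ ∈ Set.Icc 0 σ₁ := ⟨hσ₁, le_rfl⟩
  obtain ⟨hfloor, hle, hout₁⟩ := hYin σ₁ hmem
  rcases hexit with hex | hfl
  · -- exit at the threshold: y' := Y σ₁
    refine ⟨Y σ₁, le_trans (le_max_left _ _) hfloor, hle, ?_, ?_, ?_, hex⟩
    · -- high: head only grew
      have hsq : 0 ≤ ‖y‖ ^ 2 - ‖Y σ₁‖ ^ 2 := by nlinarith [norm_nonneg (Y σ₁)]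
      have : 0 ≤ κ * (‖y‖ ^ 2 - ‖Y σ₁‖ ^ 2) := mul_nonneg hκ.le hsq
      have hk : κ * (‖y‖ ^ 2 - ‖Y σ₁‖ ^ 2) = 1 / 2 * (1 - 2 * (1 / (2 + ρ))) * c₁ * (‖y‖ ^ 2 - ‖Y σ₁‖ ^ 2) := by
        rw [hκ_def]
      linarith
    · -- vortical: transported
      have := vorticityTransport ρ hρ hρ' V P' hprof σ₁ hσ₁ Y hYder
      rw [hY0] at this
      exact this hcurl
    · -- lower swirl bound: the rate is still ≥ c₁‖y'‖² > −c₁‖y'‖²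
      have hpos : 0 < c₁ * ‖Y σ₁‖ ^ 2 := by
        have : 0 < ‖Y σ₁‖ := lt_of_lt_of_le hR₁'pos hfloor
        positivity
      linarith
  · -- floor reached while still in outflow mode: the head exceeds its bound on the ball — contradiction
    exfalso
    have hYball : Y σ₁ ∈ Metric.closedBall (0 : EuclideanSpace ℝ (Fin 3)) R₁' := by
      simpa [Metric.mem_closedBall, dist_zero_right] using hfl
    have hCb := hC (Y σ₁) hYball
    have hHle : selfSimilarBernoulli (1 / (2 + ρ)) 0 V P' (Y σ₁) ≤ C :=
      le_trans (le_abs_self _) (by simpa [Real.norm_eq_abs] using hCb)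
    -- radius bookkeeping: ‖y‖² − ‖Y σ₁‖² ≥ (|C − h| + 1)/κ
    have hy1 : R₁' + 1 + (|C - h| + 1) / κ ≤ ‖y‖ := hy
    have hdiff : (|C - h| + 1) / κ ≤ ‖y‖ ^ 2 - ‖Y σ₁‖ ^ 2 := by
      have h1 : ‖Y σ₁‖ ^ 2 ≤ R₁' ^ 2 := by nlinarith [norm_nonneg (Y σ₁)]
      have h2 : R₁' ^ 2 + (|C - h| + 1) / κ ≤ ‖y‖ ^ 2 := by nlinarith
      linarith
    have hkd : |C - h| + 1 ≤ κ * (‖y‖ ^ 2 - ‖Y σ₁‖ ^ 2) := by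
      have := mul_le_mul_of_nonneg_left hdiff hκ.le
      rwa [mul_div_cancel₀ _ hκ.ne'] at this
    have hk : κ * (‖y‖ ^ 2 - ‖Y σ₁‖ ^ 2) = 1 / 2 * (1 - 2 * (1 / (2 + ρ))) * c₁ * (‖y‖ ^ 2 - ‖Y σ₁‖ ^ 2) := by
      rw [hκ_def]
    have habs : C - h ≤ |C - h| := le_abs_self _
    linarith

end OutflowDive

end Summit.NavierStokesRegularity.NavierStokesRegularity.Theorems.PowerGaugeEulerLiouville

end
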